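import Summits.CriticalPhenomena.CardyFormulaZ2.Theorems.CardyMagicRigidityPinchResamplingDefsV4
import Summits.CriticalPhenomena.CardyFormulaZ2.Theorems.CardyMagicRigidityNestingRigidityPinchLocality
import HarnessLib

/-!
# Neck-tomography vocabulary on the lattices: selected regions, germs, glued partitions, admissible states

Crux `Summit.CriticalPhenomena.CardyFormulaZ2.Theses.CardyMagicRigidity.NestingRigidity` (stmt-CriticalPhenomena-4835),
line `pinch-resampling` v4, stub S10' `stub_neckTomographyV4 : FiveArmUpperT → FiveArmUpperZ2 → NoNeckRigidity →
NeckHookupCoarseT → NeckHookupCoarseZ2 → LoopLimitZ2Blind → LoopLimitZ2EqT`.  This definitions module puts into the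
tree the LATTICE-LEVEL objects of the blob-graph structure D1 of the transfer (typing notes `S10p-typing.md`,
`S10p-typing-v2.md`; the lattice-free core is `…NestingRigidityBlobGraph`, p155140), so that later cuts can register
`BlobGraphStructure`-type stubs by name:

* §1 site percolation on `𝕋`: selected regions `tSel` (balls `Λ_{sc x}(x)` at candidate centres `x ∈ X` whose collar
  carries exactly two open and two closed crossing clusters, `TPinch x x s s`), their interiors/closed collars, the
  realised state vector `tState` (`THook`), germs `TGerm` (starts of crossings of a collar), the glued partitions
  `tGlue … c b : Setoid (Site 2)` under a hypothetical state vector `b`, admissible vectors `tAdmissibleRel`/`tAdmissible`,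
  unambiguous centres `TUnambiguous` and the state-pinned form `TUnambiguousIf`;
* §2 the `ℤ²` (bond) twins (primal colour on sites, dual colour on dual sites);
* §3 the two-lattice statements consumed by the assembly: `BlobGraphStructure` (D1), `CoarseVisible`,
  `TPositiveUnambiguous` — `Prop`-valued, parametrised by good events; NOT asserted here;
* §4 **exterior-determinedness (registered anchor `tUnambiguousIf_determinedBy`)**: for a fixed pinned value `β` of the
  state of `x`, the event "`x` is selected and unambiguous if its state is `β`" reads only the sites off `Λ_{sc x}(x)`,
  provided the closed collars of the other candidate centres avoid `Λ_{sc x}(x)` (design condition).  The UNPINNED event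
  "`x` is selected and unambiguous" is NOT exterior-determined (the wave-3 probe `probe_tUnambiguous_determinedBy` is
  FALSE): two regions `x, j` in parallel between the same two open blobs (a digon) with `j` open-hooked — if `x` is
  open-hooked the blind data force both states (unambiguous), if `x` is closed-hooked the states `(F,T)` and `(T,F)`
  induce the same partitions (ambiguous); same exterior.  The identification step therefore conditions on the pinned
  events `TUnambiguousIf … β`, `β = T, F`, which ARE exterior-determined (`tUnambiguous_iff_tUnambiguousIf`).

The multi-scale selection rule (largest clean dyadic radius), the robust hulls of context events and the dictionary
"glued = reachable" are in the companion module `…NestingRigidityTomographySelection`.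
Design decisions are recorded at the declarations; everything is sorry-free; no `Prop` definition is used as a hypothesis.
-/

noncomputable section

namespace Summit.CriticalPhenomena.CardyFormulaZ2.Cruxes.NestingRigidity.PinchResampling

open Summit.CriticalPhenomena.CardyFormulaZ2.Theses.CardyMagicRigidity
open MeasureTheory Set Relation Literature.Probability.Percolation Literature.Probability.LatticeModels
  Literature.Probability.RandomPlanarGeometry

/-! ## §1 Site percolation on `𝕋` -/

section SiteT

variable (sc : Site 2 → ℕ) (X : Set (Site 2))

/-- **Selected regions on `𝕋`**: candidate centres `x ∈ X` whose collar `Λ_{2 sc x}(x) ∖ Λ_{sc x}(x)` has exactly two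
open and two closed crossing clusters (`TPinch x x s s`, the selection event of S11); `sc` is the radius map. -/
def tSel (ω : SiteConfig (Site 2)) : Set (Site 2) := {x | x ∈ X ∧ ω ∈ TPinch x x (sc x) (sc x)}

/-- The union of the interiors `Λ_{sc x}(x)` of the selected regions (the resampled coordinates). -/
def tInteriors (ω : SiteConfig (Site 2)) : Set (Site 2) := ⋃ x ∈ tSel sc X ω, tBall x (sc x)

/-- The union of the closed collars `Λ_{2 sc x}(x)` of the selected regions. -/
def tCollars (ω : SiteConfig (Site 2)) : Set (Site 2) := ⋃ x ∈ tSel sc X ω, tBall x (2 * sc x)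

open Classical in
/-- **The realised state vector**: `true` at a selected centre whose region is open-hooked (`THook x x s s`), `false`
elsewhere (closed-hooked selected regions and, by convention, unselected centres). -/
def tState (ω : SiteConfig (Site 2)) : Site 2 → Bool :=
  fun x ↦ decide (x ∈ tSel sc X ω ∧ ω ∈ THook x x (sc x) (sc x))

/-- **Germs**: `v` starts a colour-`c` crossing of the collar of `x` (inner-layer site joined to the outer layer by a
`c`-path of the collar). -/
def TGerm (ω : SiteConfig (Site 2)) (c : Bool) (x v : Site 2) : Prop :=
  IsCrossing triGraph (tColourGraph ω c) (tBall x (sc x)) (tBall x (2 * sc x)) v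

/-- **The glued partition of colour `c` under the state vector `b`**: equivalence closure of "joined by a `c`-path
avoiding all selected interiors" (blob step) or "both are `c`-germs of a selected `x` with `b x = c`" (passage). -/
def tGlue (ω : SiteConfig (Site 2)) (c : Bool) (b : Site 2 → Bool) : Setoid (Site 2) :=
  EqvGen.setoid fun v w ↦ PathIn (tColourGraph ω c) (tInteriors sc X ω)ᶜ v w ∨
    ∃ x ∈ tSel sc X ω, b x = c ∧ TGerm sc ω c x v ∧ TGerm sc ω c x w

/-- **Admissible state vectors relative to a reference vector `b₀`**: supported on the selected centres and inducing
the same two glued partitions as `b₀`. -/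
def tAdmissibleRel (ω : SiteConfig (Site 2)) (b₀ : Site 2 → Bool) : Set (Site 2 → Bool) :=
  {b | (∀ x ∉ tSel sc X ω, b x = false) ∧ ∀ c : Bool, tGlue sc X ω c b = tGlue sc X ω c b₀}

/-- **Admissible state vectors**: those compatible with the realised glued partitions (the blind data). -/
def tAdmissible (ω : SiteConfig (Site 2)) : Set (Site 2 → Bool) := tAdmissibleRel sc X ω (tState sc X ω)

/-- **Unambiguous centres**: every admissible vector agrees there with the realised state. -/
def TUnambiguous (ω : SiteConfig (Site 2)) (x : Site 2) : Prop :=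
  ∀ b ∈ tAdmissible sc X ω, b x = tState sc X ω x

/-- **Unambiguous IF the state of `x` is `β`** (the pinned form): every vector admissible relative to the realised
states with the `x`-entry replaced by `β` has `x`-entry `β`.  For `β = tState … x` this is `TUnambiguous`; unlike it, it
reads only the exterior of `Λ_{sc x}(x)` (§4). -/
def TUnambiguousIf (ω : SiteConfig (Site 2)) (x : Site 2) (β : Bool) : Prop :=
  ∀ b ∈ tAdmissibleRel sc X ω (Function.update (tState sc X ω) x β), b x = β

/-- The realised state vector is admissible. -/
theorem tState_mem_tAdmissible (ω : SiteConfig (Site 2)) : tState sc X ω ∈ tAdmissible sc X ω := by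
  refine ⟨fun x hx ↦ ?_, fun _ ↦ rfl⟩
  simp [tState, hx]

/-- `TUnambiguous` is the pinned form at the realised value. -/
theorem tUnambiguous_iff_tUnambiguousIf (ω : SiteConfig (Site 2)) (x : Site 2) :
    TUnambiguous sc X ω x ↔ TUnambiguousIf sc X ω x (tState sc X ω x) := by
  simp only [TUnambiguous, TUnambiguousIf, tAdmissible, Function.update_eq_self]

/-- A selected region has radius `≥ 1` (the collar of radius `0` is empty, so `TPinch x x 0 0 = ∅`). -/
theorem one_le_of_mem_tSel {ω : SiteConfig (Site 2)} {x : Site 2} (hx : x ∈ tSel sc X ω) : 1 ≤ sc x := by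
  by_contra h
  have h0 : sc x = 0 := by omega
  have hm := hx.2
  rw [h0, tPinch_eq_empty_of_zero (by simp)] at hm
  exact hm

/-- Selection is exterior-determined region by region: `x ∈ tSel` reads only the collar of `x`. -/
theorem mem_tSel_iff_of_agree_off {ω ω' : SiteConfig (Site 2)} {x : Site 2}
    (h : ω ∩ (tBall x (2 * sc x) \ tBall x (sc x)) = ω' ∩ (tBall x (2 * sc x) \ tBall x (sc x))) :
    x ∈ tSel sc X ω ↔ x ∈ tSel sc X ω' := by
  simp only [tSel, mem_setOf_eq]
  rw [(determinedBy_iff _ _).1 (tPinch_determinedBy x x (sc x) (sc x)) ω ω' h]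

end SiteT

/-! ## §2 Bond percolation on `ℤ²` (primal colour on sites, dual colour on dual sites) -/

section BondZ2

variable (sc : Site 2 → ℕ) (X : Set (Site 2))

/-- **Selected regions on `ℤ²`**: centres whose primal and dual collars have exactly two crossing clusters each
(`ZFourStrands x s`, the selection event of S12). -/
def zSel (ω : BondConfig (Site 2)) : Set (Site 2) := {x | x ∈ X ∧ ω ∈ ZFourStrands x (sc x)}

/-- Primal interiors of the selected regions. -/
def zInteriors (ω : BondConfig (Site 2)) : Set (Site 2) := ⋃ x ∈ zSel sc X ω, zBall x (sc x)

/-- Dual interiors (dual boxes of radius `sc x + ½`) of the selected regions. -/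
def zDualInteriors (ω : BondConfig (Site 2)) : Set (Site 2) := ⋃ x ∈ zSel sc X ω, zDualBall x (sc x)

open Classical in
/-- **The realised state vector on `ℤ²`**: `true` = the primal hook-up `ZHookR x s` of a selected box. -/
def zState (ω : BondConfig (Site 2)) : Site 2 → Bool :=
  fun x ↦ decide (x ∈ zSel sc X ω ∧ ω ∈ ZHookR x (sc x))

/-- Primal germs: starts of open crossings of the primal collar of `x`. -/
def ZGermP (ω : BondConfig (Site 2)) (x v : Site 2) : Prop :=
  IsCrossing (zdGraph 2) (openGraph ω) (zBall x (sc x)) (zBall x (2 * sc x)) v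

/-- Dual germs: starts of dual-open crossings of the dual collar of `x`. -/
def ZGermD (ω : BondConfig (Site 2)) (x v : Site 2) : Prop :=
  IsCrossing (zdGraph 2) (openGraph (dualConfig ω)) (zDualBall x (sc x)) (zDualBall x (2 * sc x)) v

/-- **The glued primal partition on `ℤ²`** under `b`. -/
def zGlueP (ω : BondConfig (Site 2)) (b : Site 2 → Bool) : Setoid (Site 2) :=
  EqvGen.setoid fun v w ↦ PathIn (openGraph ω) (zInteriors sc X ω)ᶜ v w ∨
    ∃ x ∈ zSel sc X ω, b x = true ∧ ZGermP sc ω x v ∧ ZGermP sc ω x w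

/-- **The glued dual partition on `ℤ²`** under `b`. -/
def zGlueD (ω : BondConfig (Site 2)) (b : Site 2 → Bool) : Setoid (Site 2) :=
  EqvGen.setoid fun v w ↦ PathIn (openGraph (dualConfig ω)) (zDualInteriors sc X ω)ᶜ v w ∨
    ∃ x ∈ zSel sc X ω, b x = false ∧ ZGermD sc ω x v ∧ ZGermD sc ω x w

/-- **Admissible state vectors on `ℤ²` relative to `b₀`**. -/
def zAdmissibleRel (ω : BondConfig (Site 2)) (b₀ : Site 2 → Bool) : Set (Site 2 → Bool) :=
  {b | (∀ x ∉ zSel sc X ω, b x = false) ∧ zGlueP sc X ω b = zGlueP sc X ω b₀ ∧ zGlueD sc X ω b = zGlueD sc X ω b₀}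

/-- **Admissible state vectors on `ℤ²`**. -/
def zAdmissible (ω : BondConfig (Site 2)) : Set (Site 2 → Bool) := zAdmissibleRel sc X ω (zState sc X ω)

/-- **Unambiguous centres on `ℤ²`**. -/
def ZUnambiguous (ω : BondConfig (Site 2)) (x : Site 2) : Prop :=
  ∀ b ∈ zAdmissible sc X ω, b x = zState sc X ω x

/-- **Unambiguous if the state of `x` is `β`, on `ℤ²`**. -/
def ZUnambiguousIf (ω : BondConfig (Site 2)) (x : Site 2) (β : Bool) : Prop :=
  ∀ b ∈ zAdmissibleRel sc X ω (Function.update (zState sc X ω) x β), b x = β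

/-- The realised state vector is admissible. -/
theorem zState_mem_zAdmissible (ω : BondConfig (Site 2)) : zState sc X ω ∈ zAdmissible sc X ω := by
  refine ⟨fun x hx ↦ ?_, rfl, rfl⟩
  simp [zState, hx]

/-- `ZUnambiguous` is the pinned form at the realised value. -/
theorem zUnambiguous_iff_zUnambiguousIf (ω : BondConfig (Site 2)) (x : Site 2) :
    ZUnambiguous sc X ω x ↔ ZUnambiguousIf sc X ω x (zState sc X ω x) := by
  simp only [ZUnambiguous, ZUnambiguousIf, zAdmissible, Function.update_eq_self]

end BondZ2

/-! ## §3 The two-lattice statements (parametrised by good events; not asserted) -/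

section TwoLattice

/-- **D1 `BlobGraphStructure`, for given good events and selection data.**  Regions are indexed by the cells `C` of
one planar grid, realised on the two lattices by centre maps `xZ`, `xT` and configuration-dependent radius maps `scZ`,
`scT`.  On `GZ × GT`, blind closeness at precision `ε` of the loop configurations at mesh `δ` forces: (a) the same cells
selected with the same radii; (b) the same admissible sets (re-indexed by cells); (c) equal realised states on every
unambiguous cell.  CONSUMED by identification (A7) and by the fibre coupling (A9). -/
def BlobGraphStructure (δ ε : ℝ) (C : Set (Site 2)) (xZ xT : Site 2 → Site 2)
    (scZ : BondConfig (Site 2) → Site 2 → ℕ) (scT : SiteConfig (Site 2) → Site 2 → ℕ)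
    (GZ : Set (BondConfig (Site 2))) (GT : Set (SiteConfig (Site 2))) : Prop :=
  ∀ ωZ ∈ GZ, ∀ ωT ∈ GT, LoopConfig.IsBlindClose ε (bondLoopConfig δ 0 ωZ) (siteLoopConfig δ ωT) →
    (∀ c ∈ C, (xZ c ∈ zSel (scZ ωZ) (xZ '' C) ωZ ↔ xT c ∈ tSel (scT ωT) (xT '' C) ωT) ∧
      (xZ c ∈ zSel (scZ ωZ) (xZ '' C) ωZ → scZ ωZ (xZ c) = scT ωT (xT c))) ∧
    (fun b : Site 2 → Bool ↦ b ∘ xZ) '' zAdmissible (scZ ωZ) (xZ '' C) ωZ =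
      (fun b : Site 2 → Bool ↦ b ∘ xT) '' tAdmissible (scT ωT) (xT '' C) ωT ∧
    ∀ c ∈ C, TUnambiguous (scT ωT) (xT '' C) ωT (xT c) →
      zState (scZ ωZ) (xZ '' C) ωZ (xZ c) = tState (scT ωT) (xT '' C) ωT (xT c)

/-- **Blind visibility of the coarse datum, for given good events**: on `GZ × GT ∩ {blind-close}`, at every cell
selected on both sides the coarse blob data `zCoarse`/`tCoarse` of the two collars agree. -/
def CoarseVisible (δ ε : ℝ) (C : Set (Site 2)) (xZ xT : Site 2 → Site 2)
    (scZ : BondConfig (Site 2) → Site 2 → ℕ) (scT : SiteConfig (Site 2) → Site 2 → ℕ) (ℓ lam : ℕ) (oZ oT : Site 2)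
    (GZ : Set (BondConfig (Site 2))) (GT : Set (SiteConfig (Site 2))) : Prop :=
  ∀ ωZ ∈ GZ, ∀ ωT ∈ GT, LoopConfig.IsBlindClose ε (bondLoopConfig δ 0 ωZ) (siteLoopConfig δ ωT) →
    ∀ c ∈ C, xZ c ∈ zSel (scZ ωZ) (xZ '' C) ωZ → xT c ∈ tSel (scT ωT) (xT '' C) ωT →
      zCoarse ℓ lam (scZ ωZ (xZ c)) (xZ c) oZ ωZ = tCoarse ℓ lam (scT ωT (xT c)) (xT c) oT ωT

/-- **Positivity of shapes in unambiguous contexts on `𝕋`, pinned form** (single lattice, one cell): for every coarse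
value `σ` and pinned state `β`, `P(selected, σ, ambiguous-if-β) ≤ Cpos · P(selected, σ, unambiguous-if-β)` on the good
event `G` (RSW surgery "open one more region of the cycle"; converts the S11 error on unambiguous contexts into an error
on all contexts).  All three events read only the exterior of `Λ_{sc x}(x)` (§4). -/
def TPositiveUnambiguous (Cpos : ℝ) (sc : Site 2 → ℕ) (X : Set (Site 2)) (x : Site 2) (ℓ lam : ℕ) (o : Site 2)
    (G : Set (SiteConfig (Site 2))) : Prop :=
  ∀ (σ : Set (Set (Site 2)) × Set (Set (Site 2))) (β : Bool),
    (triSitePercolation half).real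
        (G ∩ {ω | x ∈ tSel sc X ω ∧ tCoarse ℓ lam (sc x) x o ω = σ ∧ ¬ TUnambiguousIf sc X ω x β}) ≤
      Cpos * (triSitePercolation half).real
        (G ∩ {ω | x ∈ tSel sc X ω ∧ tCoarse ℓ lam (sc x) x o ω = σ ∧ TUnambiguousIf sc X ω x β})

end TwoLattice

/-! ## §4 Exterior-determinedness of selection, glued partitions and pinned unambiguity -/

section Exterior

variable (sc : Site 2 → ℕ) (X : Set (Site 2))

/-- Configurations agreeing on `F` agree on every site of `F`. -/
theorem Tomography.mem_iff_of_inter_eq {ω ω' : SiteConfig (Site 2)} {F : Set (Site 2)} (h : ω ∩ F = ω' ∩ F) {v : Site 2}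
    (hv : v ∈ F) : v ∈ ω ↔ v ∈ ω' :=
  ⟨fun hω ↦ ((Set.ext_iff.1 h v).1 ⟨hω, hv⟩).1, fun hω ↦ ((Set.ext_iff.1 h v).2 ⟨hω, hv⟩).1⟩

/-- Configurations agreeing on `F` agree on every subset of `F`. -/
theorem Tomography.inter_eq_of_subset {ω ω' : SiteConfig (Site 2)} {F A : Set (Site 2)} (h : ω ∩ F = ω' ∩ F) (hA : A ⊆ F) :
    ω ∩ A = ω' ∩ A := by
  ext v
  simp only [mem_inter_iff]
  exact ⟨fun ⟨h1, h2⟩ ↦ ⟨(Tomography.mem_iff_of_inter_eq h (hA h2)).1 h1, h2⟩, fun ⟨h1, h2⟩ ↦ ⟨(Tomography.mem_iff_of_inter_eq h (hA h2)).2 h1, h2⟩⟩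

variable {sc X} in
/-- Interiors of selected regions lie in `tInteriors`. -/
theorem tBall_subset_tInteriors {ω : SiteConfig (Site 2)} {x : Site 2} (hx : x ∈ tSel sc X ω) :
    tBall x (sc x) ⊆ tInteriors sc X ω :=
  subset_biUnion_of_mem (u := fun y ↦ tBall y (sc y)) hx

/-- **All exterior objects agree.**  If `ω`, `ω'` agree off `Λ_{sc x}(x)` and the closed collars of the other candidate
centres avoid `Λ_{sc x}(x)`, then: the selected sets agree; the realised states agree off `x`; and if `x` is selected,
the glued partitions agree for every colour and every state vector. -/
theorem exterior_agree {x : Site 2} (hX : ∀ y ∈ X, y ≠ x → Disjoint (tBall y (2 * sc y)) (tBall x (sc x)))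
    {ω ω' : SiteConfig (Site 2)} (h : ω ∩ (tBall x (sc x))ᶜ = ω' ∩ (tBall x (sc x))ᶜ) :
    tSel sc X ω = tSel sc X ω' ∧ (∀ y ≠ x, tState sc X ω y = tState sc X ω' y) ∧
      (x ∈ tSel sc X ω → ∀ c b, tGlue sc X ω c b = tGlue sc X ω' c b) := by
  -- the big ball of every candidate centre `y ≠ x`, and the collar of `x`, lie off `Λ_{sc x}(x)`
  have hoff : ∀ y ∈ X, y ≠ x → tBall y (2 * sc y) ⊆ (tBall x (sc x))ᶜ := fun y hy hyx ↦
    (hX y hy hyx).subset_compl_right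
  have hcol : ∀ y ∈ X, tBall y (2 * sc y) \ tBall y (sc y) ⊆ (tBall x (sc x))ᶜ := by
    intro y hy
    by_cases hyx : y = x
    · subst hyx
      exact fun v hv ↦ hv.2
    · exact sdiff_subset.trans (hoff y hy hyx)
  have hsel : tSel sc X ω = tSel sc X ω' := by
    ext y
    constructor
    · intro hy
      exact (mem_tSel_iff_of_agree_off sc X (Tomography.inter_eq_of_subset h (hcol y hy.1))).1 hy
    · intro hy
      exact (mem_tSel_iff_of_agree_off sc X (Tomography.inter_eq_of_subset h (hcol y hy.1))).2 hy
  have hstate : ∀ y ≠ x, tState sc X ω y = tState sc X ω' y := by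
    intro y hyx
    by_cases hy : y ∈ X
    · have hhook : ω ∈ THook y y (sc y) (sc y) ↔ ω' ∈ THook y y (sc y) (sc y) :=
        (determinedBy_iff _ _).1 (tHook_determinedBy y y (sc y) (sc y)) ω ω' (Tomography.inter_eq_of_subset h (hoff y hy hyx))
      rw [Bool.eq_iff_iff]
      simp only [tState, decide_eq_true_eq, hsel, hhook]
    · have h1 : y ∉ tSel sc X ω := fun hh ↦ hy hh.1
      have h2 : y ∉ tSel sc X ω' := fun hh ↦ hy hh.1
      simp only [tState, h1, h2, false_and, decide_false]
  refine ⟨hsel, hstate, fun hx c b ↦ ?_⟩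
  -- germs and blob steps read only exterior sites
  have hgerm : ∀ y ∈ tSel sc X ω, ∀ v, TGerm sc ω c y v ↔ TGerm sc ω' c y v := fun y hy v ↦
    isCrossing_congr triGraph (tColourGraph_adj_iff_of_inter_eq (Tomography.inter_eq_of_subset h (hcol y hy.1)) c) v
  have hint : (tInteriors sc X ω)ᶜ ⊆ (tBall x (sc x))ᶜ := compl_subset_compl.2 (tBall_subset_tInteriors hx)
  have hpath : ∀ v w, PathIn (tColourGraph ω c) (tInteriors sc X ω)ᶜ v w ↔
      PathIn (tColourGraph ω' c) (tInteriors sc X ω)ᶜ v w := fun v w ↦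
    pathIn_congr_of_adj_iff (tColourGraph_adj_iff_of_inter_eq (Tomography.inter_eq_of_subset h hint) c) v w
  have hint' : tInteriors sc X ω' = tInteriors sc X ω := by simp only [tInteriors, hsel]
  unfold tGlue
  congr 1
  ext v w
  rw [hpath, hint', ← hsel]
  constructor
  · rintro (h1 | ⟨y, hy, hb, hv, hw⟩)
    · exact Or.inl h1
    · exact Or.inr ⟨y, hy, hb, (hgerm y hy v).1 hv, (hgerm y hy w).1 hw⟩
  · rintro (h1 | ⟨y, hy, hb, hv, hw⟩)
    · exact Or.inl h1
    · exact Or.inr ⟨y, hy, hb, (hgerm y hy v).2 hv, (hgerm y hy w).2 hw⟩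

/-- **Registered anchor: pinned unambiguity is exterior-determined.**  If the closed collars `Λ_{2 sc y}(y)` of the
candidate centres `y ≠ x` avoid the interior `Λ_{sc x}(x)` (design condition on the candidate family), then for each
pinned value `β` the event "`x` is selected and unambiguous if its state is `β`" is determined by the sites off
`Λ_{sc x}(x)`.  (Selection, germs, blob steps and the states of the other regions read only exterior sites —
`exterior_agree` — and the pinned reference vector `update (tState …) x β` does not read the state of `x`.)  This is
the form in which identification (A7) applies the splice identity `real_tHook_inter_eq_integral_splice`. -/
theorem tUnambiguousIf_determinedBy : ∀ (sc : Site 2 → ℕ) (X : Set (Site 2)) (x : Site 2), (∀ y ∈ X, y ≠ x → Disjoint (tBall y (2 * sc y)) (tBall x (sc x))) → ∀ β : Bool, DeterminedBy {ω | x ∈ Summit.CriticalPhenomena.CardyFormulaZ2.Cruxes.NestingRigidity.PinchResampling.tSel sc X ω ∧ Summit.CriticalPhenomena.CardyFormulaZ2.Cruxes.NestingRigidity.PinchResampling.TUnambiguousIf sc X ω x β} (tBall x (sc x))ᶜ := by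
  intro sc X x hX β
  rw [determinedBy_iff]
  intro ω ω' h
  obtain ⟨hsel, hstate, hglue⟩ := exterior_agree sc X hX h
  have hupd : Function.update (tState sc X ω) x β = Function.update (tState sc X ω') x β := by
    funext y
    by_cases hyx : y = x
    · subst hyx
      simp
    · simp [Function.update_of_ne hyx, hstate y hyx]
  simp only [mem_setOf_eq]
  constructor
  · rintro ⟨hx, hU⟩
    refine ⟨hsel ▸ hx, fun b hb ↦ hU b ?_⟩
    obtain ⟨hb1, hb2⟩ := hb
    exact ⟨fun y hy ↦ hb1 y (hsel ▸ hy), fun c ↦ by rw [hglue hx c b, hglue hx c, hupd]; exact hb2 c⟩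
  · rintro ⟨hx, hU⟩
    have hx' : x ∈ tSel sc X ω := hsel ▸ hx
    refine ⟨hx', fun b hb ↦ hU b ?_⟩
    obtain ⟨hb1, hb2⟩ := hb
    exact ⟨fun y hy ↦ hb1 y (hsel ▸ hy), fun c ↦ by rw [← hglue hx' c b, ← hupd, ← hglue hx' c]; exact hb2 c⟩

/-- Corollary: the unpinned event splits along the realised state into two pieces, each the intersection of an
exterior-determined pinned event with the interior-dependent hook-up event. -/
theorem tSel_and_tUnambiguous_iff (ω : SiteConfig (Site 2)) (x : Site 2) :
    (x ∈ tSel sc X ω ∧ TUnambiguous sc X ω x) ↔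
      (x ∈ tSel sc X ω ∧ ω ∈ THook x x (sc x) (sc x) ∧ TUnambiguousIf sc X ω x true) ∨
        (x ∈ tSel sc X ω ∧ ω ∉ THook x x (sc x) (sc x) ∧ TUnambiguousIf sc X ω x false) := by
  rw [tUnambiguous_iff_tUnambiguousIf]
  by_cases hx : x ∈ tSel sc X ω
  · by_cases hh : ω ∈ THook x x (sc x) (sc x)
    · simp [tState, hx, hh]
    · simp [tState, hx, hh]
  · simp [hx]

end Exterior


end Summit.CriticalPhenomena.CardyFormulaZ2.Cruxes.NestingRigidity.PinchResampling

end
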